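import Mathlib
import HarnessLib
import HarnessLib.Audit
import Summits.MatrixMultiplication.Statement

/-!
Route: FourierTwoFamilies

CLOSED (retired) 2026-08-15T13:48:54Z by operator:999:1257524 — reason: not-a-thesis: assembly does not conclude the sub-problem Statement — note: D-0027 §2.1 audit (human 2026-08-15: routes that do not decide the summit are removed): the assembly concludes `TwoFamiliesRefutation`, not the sub-problem statement; a NEW conforming route may be opened from the same idea (generated `closes : … → _root_.MatrixMultiplication`).. The file is kept as the record of this route; refuted decls are indexed as negative knowledge (`ledger negatives`).

# Route FourierTwoFamilies — Linear Fourier analysis against the CKSU two-families conjecture —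
half-density, forced common-frequency bias, density increment in cyclic groups

NEGATIVE-KNOWLEDGE ROUTE (declared up front: X does NOT imply `MatrixMultiplication` and is not
claimed to). X = TwoFamiliesRefutation:
the "two families" conjecture of Cohn–Kleinberg–Szegedy–Umans (CKSU 2005 Conj. 4.7) is FALSE in
finite abelian groups, in the effective
form that is literally the negation of the text of `GroupTheoreticSTPP.CPackingConstruction`
(stmt-MatrixMultiplication-0595, the rank-2
construction crux of route GroupTheoreticSTPP): there are δ > 0 and n₀ such that for n ≥ n₀ no
finite abelian group H with |H| ≤ n^(2+δ)
carries n pairs (A_i, B_i) with the simultaneous double product property ((W) every A_i ⊕ B_i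
direct; (X) a − a′ + b − b′ = 0 with
a ∈ A_i, a′ ∈ A_j, b ∈ B_j, b′ ∈ B_k forces i = k) and |A_i||B_i| ≥ n^(2−δ). It suffices to show the
crux BalancedPowerGain (a fixed power
saving over the trivial count |H| ≥ n·s for balanced configurations, uniformly over all finite
abelian groups); the Assembly is the
elementary reduction BalancedPowerGain → X. Realises idea card fourier-two-families-half-density
(spine); the engine is L²/linear Fourier
analysis of the SDPP system (a complexity-1 system of four-variable equations), whose first
consequences — pairwise disjointness, the
half-density theorem 2ns² ≤ |H|(s+1), and a forced common-frequency bias beyond the "wall" |H| < ns²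
— are filed as provable-now support.
Proving X closes stmt-0595 as refuted (route GroupTheoreticSTPP then re-ranks to its non-abelian
crux) and adds a Fourier entry to the
barrier catalogue for unbounded-exponent abelian hosts, the declared blind spot of
TricoloredSumFreeBarrier.
Lean: `¬ (∀ δ : ℝ, 0 < δ → ∀ n₀ : ℕ, ∃ n ≥ n₀, ∃ (H : Type) (_ : AddCommGroup H) (_ : Fintype H) (A
B : Fin n → Finset H), (∀ i : Fin n, ∀ a ∈ A i, ∀ a' ∈ A i, ∀ b ∈ B i, ∀ b' ∈ B i, (a - a') + (b -
b') = 0 → a = a' ∧ b = b') ∧ (∀ i j k : Fin n, ∀ a ∈ A i, ∀ a' ∈ A j, ∀ b ∈ B j, ∀ b' ∈ B k, (a -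
a') + (b - b') = 0 → i = k) ∧ (Fintype.card H : ℝ) ≤ (n : ℝ) ^ (2 + δ) ∧ ∀ i : Fin n, (n : ℝ) ^ (2 -
δ) ≤ (((A i).card * (B i).card : ℕ) : ℝ))`

## Assembly
Negative-knowledge assembly, NOT an implication to the summit: BalancedPowerGain →
TwoFamiliesRefutation. Elementary and provable now
(difficulty M, real-exponent bookkeeping): assume CPackingConstruction with δ < c/(3+2c) and n
large; PairwiseDisjoint gives Σ_i max(|A_i|,|B_i|)
≤ 2|H| ≤ 2n^(2+δ), so at least n/2 indices have max ≤ 4n^(1+δ) and hence min(|A_i|,|B_i|) ≥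
n^(2−δ)/(4n^(1+δ)) = n^(1−2δ)/4 =: s; shrink those
A_i, B_i to subsets of the common size s (subsets inherit (W) and (X)), reindex the subfamily by Fin
⌈n/2⌉ along an injection, and apply
BalancedPowerGain: (n/2)·(n^(1−2δ)/4)^(1+c) ≤ |H| ≤ n^(2+δ), false for large n since 2 + c − 2δ(1+c)
> 2 + δ. The other cruxes are the
ranked waypoints of the same engine (PrimeCyclicWall → PrimeCyclicPowerGain; BalancedPowerGain →
PrimeCyclicPowerGain ∧ DensityDecay;
HalfDensity → DensityDecay for ε > 1/2), not extra hypotheses of the assembly.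

Rationale: WHY THIS LINE. The SDPP system is a family of single linear equations a + b = a′ + b′ with index
constraints, i.e. of (true) complexity 1
(GowersWolf2010TrueComplexity), so L² Fourier analysis on the dual group controls it in EVERY finite
abelian group with no exponent
hypothesis — exactly where the catalogued engine (slice rank,
BlasiakChurchCohnGrochowNaslundSawinUmans2017 Thm A/B) is void (cyclic
groups have full slice rank, BlasiakChurchCohnGrochowUmans2017 Thm B.8) and where BCCGNSU §2 (p. 6)
record that Thm B "addresses only very
special cases of the two families conjecture". Summing (X) over the middle index gives one
orthogonality relation
Σ_ξ [conj(S_A) S_B D − |D|²] = 0 with D(ξ) = Σ_i Â_i(ξ) conj(B̂_i(ξ)); with Parseval, (W) (matched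
representation function ≤ n) and
disjointness it yields the half-density theorem and, beyond the wall |H| < ns², a nontrivial
character at which the whole pair family is
biased by the relative amount ρ = ns/|H| (random level 1/s) — the input of a Roth/Bourgain density
increment (TaoVu2006 Ch. 4 and 10;
arXiv:2302.05537 Kelley–Meka; arXiv:2007.03528 Bloom–Sisask; arXiv:math/0310476 Green's regularity
in general abelian groups). Imported
area: additive combinatorics / discrete harmonic analysis, brought to bear on the group-theoretic
approach's last open abelian regime; the
planner's calibration (this session): CKSU Prop. 4.5 in (ℤ/3)^(2l) has n·s² = (16/9)^l/√(πl)·|H| → ∞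
and n·s^1.1699 ≈ |H|, so the card's
"wall" is a CYCLIC-group phenomenon at best and every all-abelian statement below is cut to a power
gain c < 0.17. Nothing in the
negatives index (empty) or in prior routes (GroupTheoreticSTPP is constructive; its negative crux
stmt-0596 is slice-rank-shaped and
about STPP sums, not SDPP) attacks Conj. 4.7 analytically.

RANKED CRUXES. #0 TwoFamiliesRefutation (target) — CKSU Conj. 4.7 fails in finite abelian groups
(effective): the literal negation of the text of GroupTheoreticSTPP.CPackingConstruction
(stmt-0595), so that a proof closes that item as refuted. (why it might fail: Conj. 4.7 may be true:
unbounded exponent is untouched by Thm B (BCCGNSU §2 p. 6), and the only recorded limitations are α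
≤ β, α + 2 ≤ 2β (CKSU Prop. 4.6) and Pratt's conditional Thm 4.7; no analytic obstruction exists in
print.) [CohnKleinbergSzegedyUmans2005, BlasiakChurchCohnGrochowNaslundSawinUmans2017, Pratt2024,
lean:Summit.MatrixMultiplication.MatrixMultiplication.Theses.GroupTheoreticSTPP.CPackingConstruction]
#2 BalancedPowerGain (crux) — there are c > 0 and s₀ such that in every finite abelian group H,
every balanced two-families configuration (n pairs, |A_i| = |B_i| = s ≥ s₀, (W), (X)) satisfies
n·s^(1+c) ≤ |H| — a fixed power saving over the disjointness bound n·s ≤ |H| (card items C1+C2 in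
the form the Assembly consumes). Hardest and most informative: it is the whole refutation modulo
bookkeeping. [deps: PrimeCyclicPowerGain, DensityDecay] [difficulty: open-problem] (why it might
fail: It is balanced ¬Conj 4.7 with a fixed power: CKSU Prop 4.5 in (Z/3)^(2l) has n·s^1.1699 ≈ |H|,
so c ≤ 0.17 and a proof must lose exactly what coordinate/subgroup designs gain; a growing-exponent
sequence of such designs with c → 0 IS Conj 4.7.) [CohnKleinbergSzegedyUmans2005,
BlasiakChurchCohnGrochowNaslundSawinUmans2017, Pratt2024, TaoVu2006, arXiv:math/0310476]
#3 PrimeCyclicPowerGain (crux) — the same fixed power saving n·s^(1+c) ≤ p for balanced two-families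
configurations in prime cyclic groups ℤ/pℤ (card crux C1: the home ground of the Fourier engine —
every nonzero frequency has full order, Bohr sets are arithmetic progressions, no
subgroup/coordinate designs exist). [deps: HalfDensity, CommonFrequencyBias] [difficulty: XL] (why
it might fail: Density increments give log-type savings, not powers (Behrend); the forced bias is ρ
= ns/p ≥ s^(−c), polynomially small, so a Roth iteration survives O(1) steps only — a
multiplicative/energy increment from the family structure is needed and unproved; multi-scale digit
designs in Z/p are untested.) [CohnKleinbergSzegedyUmans2005, TaoVu2006, arXiv:2302.05537,
arXiv:2007.03528, Beker2025, Pratt2024]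
#4 DensityDecay (crux) — qualitative Roth-type theorem for the SDPP system: for every ε > 0 there is
s₀ such that in every finite abelian group every balanced two-families configuration with s ≥ s₀ has
n·s ≤ ε|H| (the families occupy a vanishing fraction of the group). HalfDensity gives ε = 1/2 +
o(1); BalancedPowerGain implies it; it is the first statement an increment (relative half-density on
Bohr sets + the common-frequency bias) must deliver. [deps: HalfDensity, CommonFrequencyBias]
[difficulty: L] (why it might fail: Needs a Bohr-set-relative HalfDensity and an increment step
nobody has written (the bias sits at one frequency but the n sets tilt toward different arcs); could
even be false via fat-digit coordinate designs in (Z/M)^(2l) keeping ns/|H| ≥ ε as s → ∞ (none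
known; CKSU Prop 4.5 decays).) [CohnKleinbergSzegedyUmans2005, TaoVu2006, arXiv:math/0310476,
arXiv:2302.05537, GowersWolf2010TrueComplexity]
#5 PrimeCyclicWall (crux) — the matched-difference wall in prime cyclic groups: an absolute C with
n·s² ≤ C·p for every balanced two-families configuration in ℤ/pℤ (the card's structural conjecture
"N ≥ (1 − o(1)) n s²", weakened to a constant; translates of one direct pair attain n·s² ≈ p).
Implies PrimeCyclicPowerGain at once; its refutation (unbounded n·s²/p) would be the first
overlapping-difference SDPP design in a cyclic group and re-ranks the route. [difficulty:
open-problem] (why it might fail: Evidence is thin: translates give ns² ≤ p and base-(2D+1) digit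
simulations of CKSU Prop 4.5 give ratio → 0, but overlapping matched-difference designs
(multiplicity ≫ 1 on A_j − B_j) in Z/p were never searched; the (Z/3)^(2l) analogue is false with
ratio (16/9)^l/√l.) [CohnKleinbergSzegedyUmans2005, Pratt2024, BlasiakCohnGrochowPrattUmans2023]
#9 PairwiseDisjoint (support) — (X) with all A_j, B_j non-empty forces the A_i pairwise disjoint and
the B_i pairwise disjoint (CKSU Prop. 4.6 proof; Pratt Prop. 2.6); hence Σ|A_i| ≤ |H|, Σ|B_i| ≤ |H|.
Also a retriage note for stmt-0595. [difficulty: provable-now] [CohnKleinbergSzegedyUmans2005,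
Pratt2024]
#9 HalfDensity (support) — half-density theorem, balanced form: (W), (X), |A_i| = |B_i| = s ≥ 1
imply 2·n·s² ≤ |H|·(s+1), i.e. the families fill at most half the group up to 1/s (general form: αβ
− |H|n ≤ √(α(|H|−α)β(|H|−β)) with α = Σ|A_i|, β = Σ|B_i|, tight on single factorizations A ⊕ B = H
and on CKSU's trivial example). Proof: the orthogonality identity Σ_ξ[conj(S_A)S_B·D − |D|²] = 0,
the ξ = 0 term M(αβ − M), Σ_ξ|D|² ≤ |H|·n·M from (W), |D| ≤ M pointwise, Cauchy–Schwarz + Parseval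
for the indicators of the two disjoint unions. [difficulty: provable-now] [TaoVu2006,
CohnKleinbergSzegedyUmans2005]
#9 CommonFrequencyBias (support) — forced common-frequency bias beyond the wall: if (W), (X), |A_i|
= |B_i| = s ≥ 1 and |H| < n·s², there is a nontrivial character ψ of H with n·s·(n·s² − |H|) ≤ (|H|
− n·s)·|Σ_i Â_i(ψ)·conj(B̂_i(ψ))|, i.e. relative bias ≥ (ρ − 1/s)/(1 − ρ), ρ = ns/|H|, of the pair
family at ONE frequency (random level ≈ 1/s); checked on CKSU Prop 4.5 where a coordinate character
gives |D| = M/2. The inverse-theorem input of every increment in this route. [difficulty: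
provable-now] [TaoVu2006, CohnKleinbergSzegedyUmans2005]

TWO-LAYER PLAN. Foreseen glued splits (none filed now; k ≤ 3, depth 1): DensityDecay ⇐
RelativeHalfDensity (HalfDensity for configurations inside regular
Bohr sets / pairs of intervals, constants < 1) → BohrIncrement (common-frequency bias ⟹ a balanced
sub-configuration on a Bohr set of rank +1
with relative density ×(1 + cρ) and s′ ≥ c(ρ)s) → DensityDecay. PrimeCyclicPowerGain ⇐
IntervalIncrement (the same step inside ℤ/pℤ with
arithmetic progressions, made MULTIPLICATIVE or energy-type so that polynomially small ρ is
affordable) → DigitEndgame (configurations whose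
pairs live in short intervals obey p ≥ (1 − o(1))·n·s² by direct counting) → PrimeCyclicPowerGain.
BalancedPowerGain ⇐ PrimeCyclicPowerGain-type
argument on Bohr sets → CosetInduction (a biased character of small order means the configuration
respects cosets of its kernel; induct on |H|
with a loss calibrated so that (ℤ/3)^(2l) designs, c ≤ 0.17, are not contradicted) →
BalancedPowerGain.

KILL CRITERIA. DensityDecay refuted (balanced configurations with s → ∞ at density ≥ ε₀): the
Fourier/increment engine is dead and the witness is the best
SDPP design ever found — close `refuted:DensityDecay` and hand the family to route
GroupTheoreticSTPP (evidence for stmt-0595).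
BalancedPowerGain refuted (for every c > 0, large-s designs with n·s^(1+c) > |H|): this is Conj. 4.7
in balanced form — close
`refuted:BalancedPowerGain`; X is then unreachable by any line. PrimeCyclicPowerGain refuted ⟹
BalancedPowerGain refuted (same close).
PrimeCyclicWall refuted (n·s²/p unbounded in ℤ/pℤ): NOT fatal — repair by `--drop PrimeCyclicWall`
(the Assembly does not use it) and record
the design; it re-ranks PrimeCyclicPowerGain to 2. Mooted: stmt-0595 CPackingConstruction PROVED
elsewhere ⟹ X false ⟹ close
`refuted:TwoFamiliesRefutation`; stmt-0596 CAbelianObstructionNeg proved elsewhere makes X a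
corollary (via CKSU Thm 4.3/4.4, SDPP ⇒ STPP in H³)
— close `superseded`.

NOT DECOMPOSED YET. The increment lemmas themselves (relative half-density on Bohr sets, the
Bohr/interval increment, the digit endgame, the coset induction) —
layer-2 children once DensityDecay or PrimeCyclicPowerGain shows which potential function moves; the
unbalanced and composite-cyclic (ℤ/Nℤ)
versions (the Assembly's pigeonhole makes balanced suffice; composite N sits between cruxes 3 and
2); explicit constants c, s₀, C; the
Fourier identity and Σ|D|² ≤ |H|·n·M as separate lemmas (they ride with HalfDensity via
`--supports`); the positive horn (a finite design in
ℤ/pℤ with n·s² > 10p) — it is the cheapest falsifier, run by refuters, not an item; the sequel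
"general STPP = complexity-2 system, U³/quadratic
Fourier analysis" (another card, retired into this one) — out of scope until a crux here closes.

CHEAPEST FALSIFIER. A kit search refuters should run first: exhaustive / SAT enumeration of balanced
two-families configurations in ℤ/pℤ for p ≤ 61 and
s ∈ {2, 3, 4} (and in ℤ/Nℤ, N ≤ 64), maximising n; report max n·s²/p against the translate value
⌊p/s²⌋·s²/p ≤ 1. Any ratio > 1 that GROWS
with p kills PrimeCyclicWall and is the first overlapping-difference SDPP design in a cyclic group;
a ratio pinned at ≤ 1 + O(1/s) supports
the whole line. RUN BY THE PLANNER at s = 2 (folder wallsearch.py, exact backtracking over all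
direct pairs with |A| = |B| = 2, symmetry A₁ = {0,1}, 0 ∈ B₁): the maximal n in ℤ/pℤ equals the
translate value ⌊p/4⌋ for p = 7, 11, 13, 17, 19 (n = 1, 2, 3, 4, 4; exhaustive, 0.0–112 s each),
i.e. n·s² ≤ p with NO breach at s = 2, p ≤ 19 (p = 23, n = 6 inconclusive at 280 s); s ≥ 3 needs the
kit/SAT encoding. Planner's other checks this session (folder sanity.py, seconds): HalfDensity and
CommonFrequencyBias hold on all greedy random
configurations tried (p ≤ 25) and on CKSU Prop 4.5 at (m, l) = (3, 2) (n = 6, s = 4, |H| = 81: W, X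
verified, n·s²/|H| = 1.185 — the wall is
already breached in (ℤ/3)⁴, which is why no all-abelian wall is filed). Lookup falsifier: a
design-theory construction ("disjoint/external
difference families", near-factorisations) giving pairs A_j ⊕ B_j with a COMMON difference set and
cross differences avoiding it in ℤ/Nℤ
would do the same — not found (hybrid search of the held design-theory books below returns only
classical difference sets).

NUMBERS. Trivial: |H| ≥ n·s (PairwiseDisjoint; CKSU Prop 4.6 ⇒ α + 2 ≤ 2β), |H| ≥ s² ((W); α ≤ β).
New, provable now: |H| ≥ 2n·s²/(s+1) (HalfDensity).
One-shape families (all pairs translates of one direct pair (A, B)): n·|A||B| ≤ |H| (injectivity of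
V × (A+B) → H since (V−V) ∩ ((A+B)−(A+B)) = {0};
two-families analogue of card stpp-shape-diversity-law), attained by A = [0,s), B = s·[0,s), x_i
spaced s² apart in ℤ/pℤ: n = ⌊p/s²⌋.
CKSU Prop 4.5 (held text 'Proposition 24'), H = (ℤ/m)^(2l): n = C(2l,l), s = (m−1)^l, |H| = m^(2l);
n·s²/|H| = C(2l,l)((m−1)/m)^(2l) → ∞ for
m ≥ 3 (1.185 at m = 3, l = 2); power-gain cap c ≤ (2 log m − log 4)/log(m−1) − 1 = 0.1699 (m = 3),
0.262 (m = 4), 0.322 (m = 5), → 1 (m → ∞);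
density n·s/|H| = (4(m−1)/m²)^l/√(πl) → 0. Digit simulation of Prop 4.5 in ℤ/pℤ (base 2D+1, digits
1..D, p ≈ 2(2D+1)^(2l)): SDPP holds,
n·s²/p ≈ (2D/(2D+1))^(2l)/(2√(πl)) → 0. Conjecture regime: |H| ≤ n^(2+δ), |A_i||B_i| ≥ n^(2−δ); the
Assembly needs δ < c/(3+2c). Forced bias
(CommonFrequencyBias): relative (ρ − 1/s)/(1 − ρ) with ρ = n·s/|H| versus ≈ 1/s for random s-sets;
on CKSU Prop 4.5 a coordinate character has
|D| = M/2. Small-p census (s = 2, exact): n_max(p) = ⌊p/4⌋ for p ∈ {7, 11, 13, 17, 19} —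
PrimeCyclicWall holds with C = 1 there. Items at open: 9 (1 target, 1 assembly, 4 cruxes, 3
support).

DEFINITION REQUESTS. IsSDPP (Literature/Computability/AlgebraicComplexity, next to `IsSTPP`): `def
IsSDPP {H} [AddCommGroup H] {n} (A B : Fin n → Finset H) : Prop :=
(W) ∧ (X)` with the two clauses exactly as inlined in CPackingConstruction and in every item here,
plus `isSDPP_iff` (Iff.rfl) — CKSU 2005 §4
Definition (simultaneous double product property; 'Definition 20' of the held text), additive form.
Filed after open with `--for` the target item.
No cite facts are needed: every item is self-contained additive combinatorics over Mathlib (Finset,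
AddChar, ZMod).

Novelty: Searches (2026-08-15): `lit galaxy search "simultaneous double product property" --star all` (3
hits: CKSU05 pdf, Stothers 2010 thesis ×2 —
read pp. 78–82: restates Def./Thm. only); `lit frontier MatrixMultiplication --since 2021` (30 rows,
none on SDPP); `lit bridges MatrixMultiplication
--cross any` (30 rows, none); `lit citing arxiv:math/0511460 --since 2019` (49 works; SDPP-relevant
only arXiv:2309.03878, arXiv:2404.07380,
arXiv:2402.19169); `lit read arxiv:math/0511460` pp. 7–8 and `lit read arxiv:1605.06702` p. 6
(quoted above); `lit search --hybrid "two families conjecture simultaneous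
double product property … unbounded exponent"` (12 held docs; only
book:landsberg2017-geometry-complexity-theory pp. 78/233/313 touches CKSU,
expository); `lit search --hybrid "external difference family … common difference set cyclic group"`
(10 design-theory books: Baumert 1971,
Lander 1983, Hughes–Piper 1985 … — classical difference sets, nothing on families of direct pairs);
arXiv API 429 in this session; plus the
card's zbMATH queries and the refuter audit (`lit read 2309.03878 --grep Fourier|Bohr|increment` = 0
hits).
Nearest prior art found: Pratt2024 (arXiv:2309.03878) Prop 2.6 — disjointness and the
induced-matching (hyper)graph reformulation of SDPP
(= PairwiseDisjoint and the card's L2, KNOWN) and the combinatorial skew-corner obstruction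
programme (Thm 4.7, Conj 4.1; proxies dead by
Beker2025); CohnKleinbergSzegedyUmans2005 §4 (Conj 4.7, Prop 4.5, Prop 4.6 = the only printed  [refs: math/0511460, 2309.03878, 2404.07380, 2402.19169, 1605.06702, arxiv:math/0511460, arxiv:1605.06702, book:landsberg2017-geometry-complexity-theory, Pratt2024, Beker2025, CohnKleinbergSzegedyUmans2005, BlasiakChurchCohnGrochowNaslundSawinUmans2017]

Barriers (technique_class: STPP-abelian-unbounded-exponent, fourier-density-increment): - technique_class: STPP-abelian-unbounded-exponent, fourier-density-increment
- Literature.Barriers.MatrixMultiplication.TricoloredSumFreeBarrier: no evasion needed — the route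
is on the barrier's side and works in its declared blind spot (evasions_known (a): cyclic /
unbounded-exponent abelian hosts, where slice rank is full, BCCGU Thm B.8, and Behrend sets exist)
with a different engine (L² Fourier analysis of a complexity-1 system); it aims to EXTEND the
barrier's conclusion to the two-families sub-line there, and its all-abelian cruxes are cut (c <
0.17) to respect the bounded-exponent designs of CKSU Prop 4.5 that the barrier already prices.
- Literature.Barriers.MatrixMultiplication.EquivoluminousBarrier: does not bite (no CW §11
hypothesis is used); same genre — an additive-combinatorial hypothesis for ω = 2 met by counting.
- Literature.Barriers.MatrixMultiplication.NilpotentGroupBarrier: n/a (abelian hosts only); the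
sequel 'general STPP = complexity-2 system' would start where this barrier's non-abelian
bounded-exponent hosts live.
- Literature.Barriers.MatrixMultiplication.NormalizerBarrier: n/a — non-abelian TPP subgroup
constructions; nothing here is a subgroup triple.
- Literature.Barriers.MatrixMultiplication.QuasirandomBarrier: n/a — quasirandom (non-abelian)
hosts; abelian groups have all character degrees 1.
- Literature.Barriers.MatrixMultiplication.YoungSubgroupBarrier: n/a — S_n Young-subgroup TPP
triples.
- Literature.Barriers.MatrixMultiplication.Univer

History (route lifecycle, newest last):
- 2026-08-15T13:48:54Z · CLOSED retired — not-a-thesis: assembly does not conclude the sub-problem Statement (operator:999:1257524)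

sub-problem: MatrixMultiplication · status: closed(retired) · opened planner-plancard-MatrixMultiplication-MatrixM-116d40f8-0 2026-08-15T11:43:40Z · rev 1 · ledger route-MatrixMultiplication-FourierTwoFamilies
GENERATED by the gate from the ledger (D-0016/17). Provers cite these decls: `theorem foo : Summit.MatrixMultiplication.MatrixMultiplication.Theses.FourierTwoFamilies.<Decl> := …` in Summits/MatrixMultiplication/MatrixMultiplication/Theorems/<Name>.lean.
-/

namespace Summit.MatrixMultiplication.MatrixMultiplication.Theses.FourierTwoFamilies

open scoped BigOperators Topology Manifold Classical MeasureTheory ProbabilityTheory Matrix InnerProductSpace ComplexConjugate ContinuousMap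
open Filter Set Function TopologicalSpace MeasureTheory

attribute [summit_statement] _root_.MatrixMultiplication

/-- item stmt-MatrixMultiplication-5960 · target · rank 0 · closed · moot by None · by planner
why it might fail: Conj. 4.7 may be true: unbounded exponent is untouched by Thm B (BCCGNSU §2 p. 6), and the only recorded limitations are α ≤ β, α + 2 ≤ 2β (CKSU Prop. 4.6) and Pratt's conditional Thm 4.7; no analytic obstruction exists in print.
sources: CohnKleinbergSzegedyUmans2005, BlasiakChurchCohnGrochowNaslundSawinUmans2017, Pratt2024, lean:Summit.MatrixMultiplication.MatrixMultiplication.Theses.GroupTheoreticSTPP.CPackingConstruction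
[target] CKSU Conj. 4.7 fails in finite abelian groups (effective): the literal negation of the text
of GroupTheoreticSTPP.CPackingConstruction (stmt-0595), so that a proof closes that item as refuted. -/
@[route_item "route-MatrixMultiplication-FourierTwoFamilies"]
def TwoFamiliesRefutation : Prop :=
  ¬ (∀ δ : ℝ, 0 < δ → ∀ n₀ : ℕ, ∃ n ≥ n₀, ∃ (H : Type) (_ : AddCommGroup H) (_ : Fintype H) (A B : Fin n → Finset H), (∀ i : Fin n, ∀ a ∈ A i, ∀ a' ∈ A i, ∀ b ∈ B i, ∀ b' ∈ B i, (a - a') + (b - b') = 0 → a = a' ∧ b = b') ∧ (∀ i j k : Fin n, ∀ a ∈ A i, ∀ a' ∈ A j, ∀ b ∈ B j, ∀ b' ∈ B k, (a - a') + (b - b') = 0 → i = k) ∧ (Fintype.card H : ℝ) ≤ (n : ℝ) ^ (2 + δ) ∧ ∀ i : Fin n, (n : ℝ) ^ (2 - δ) ≤ (((A i).card * (B i).card : ℕ) : ℝ))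

/-- item stmt-MatrixMultiplication-5961 · crux · rank 2 · closed · moot by None · by planner
why it might fail: It is balanced ¬Conj 4.7 with a fixed power: CKSU Prop 4.5 in (Z/3)^(2l) has n·s^1.1699 ≈ |H|, so c ≤ 0.17 and a proof must lose exactly what coordinate/subgroup designs gain; a growing-exponent sequence of such designs with c → 0 IS Conj 4.7.
sources: CohnKleinbergSzegedyUmans2005, BlasiakChurchCohnGrochowNaslundSawinUmans2017, Pratt2024, TaoVu2006, arXiv:math/0310476
[crux] there are c > 0 and s₀ such that in every finite abelian group H, every balanced two-families
configuration (n pairs, |A_i| = |B_i| = s ≥ s₀, (W), (X)) satisfies n·s^(1+c) ≤ |H| — a fixed power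
saving over the disjointness bound n·s ≤ |H| (card items C1+C2 in the form the Assembly consumes).
Hardest and most informative: it is the whole refutation modulo bookkeeping. [deps:
PrimeCyclicPowerGain, DensityDecay] [difficulty: open-problem] -/
@[route_item "route-MatrixMultiplication-FourierTwoFamilies"]
def BalancedPowerGain : Prop :=
  ∃ c : ℝ, 0 < c ∧ ∃ s₀ : ℕ, ∀ (H : Type) [AddCommGroup H] [Fintype H] (n s : ℕ) (A B : Fin n → Finset H), s₀ ≤ s → (∀ i : Fin n, (A i).card = s ∧ (B i).card = s) → (∀ i : Fin n, ∀ a ∈ A i, ∀ a' ∈ A i, ∀ b ∈ B i, ∀ b' ∈ B i, (a - a') + (b - b') = 0 → a = a' ∧ b = b') → (∀ i j k : Fin n, ∀ a ∈ A i, ∀ a' ∈ A j, ∀ b ∈ B j, ∀ b' ∈ B k, (a - a') + (b - b') = 0 → i = k) → (n : ℝ) * (s : ℝ) ^ (1 + c) ≤ (Fintype.card H : ℝ)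

/-- item stmt-MatrixMultiplication-5962 · crux · rank 3 · closed · moot by None · by planner
why it might fail: Density increments give log-type savings, not powers (Behrend); the forced bias is ρ = ns/p ≥ s^(−c), polynomially small, so a Roth iteration survives O(1) steps only — a multiplicative/energy increment from the family structure is needed and unproved; multi-scale digit designs in Z/p are untested.
sources: CohnKleinbergSzegedyUmans2005, TaoVu2006, arXiv:2302.05537, arXiv:2007.03528, Beker2025, Pratt2024
[crux] the same fixed power saving n·s^(1+c) ≤ p for balanced two-families configurations in prime
cyclic groups ℤ/pℤ (card crux C1: the home ground of the Fourier engine — every nonzero frequency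
has full order, Bohr sets are arithmetic progressions, no subgroup/coordinate designs exist). [deps:
HalfDensity, CommonFrequencyBias] [difficulty: XL] -/
@[route_item "route-MatrixMultiplication-FourierTwoFamilies"]
def PrimeCyclicPowerGain : Prop :=
  ∃ c : ℝ, 0 < c ∧ ∃ s₀ : ℕ, ∀ p : ℕ, p.Prime → ∀ (n s : ℕ) (A B : Fin n → Finset (ZMod p)), s₀ ≤ s → (∀ i : Fin n, (A i).card = s ∧ (B i).card = s) → (∀ i : Fin n, ∀ a ∈ A i, ∀ a' ∈ A i, ∀ b ∈ B i, ∀ b' ∈ B i, (a - a') + (b - b') = 0 → a = a' ∧ b = b') → (∀ i j k : Fin n, ∀ a ∈ A i, ∀ a' ∈ A j, ∀ b ∈ B j, ∀ b' ∈ B k, (a - a') + (b - b') = 0 → i = k) → (n : ℝ) * (s : ℝ) ^ (1 + c) ≤ (p : ℝ)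

/-- item stmt-MatrixMultiplication-5963 · crux · rank 4 · closed · moot by None · by planner
why it might fail: Needs a Bohr-set-relative HalfDensity and an increment step nobody has written (the bias sits at one frequency but the n sets tilt toward different arcs); could even be false via fat-digit coordinate designs in (Z/M)^(2l) keeping ns/|H| ≥ ε as s → ∞ (none known; CKSU Prop 4.5 decays).
sources: CohnKleinbergSzegedyUmans2005, TaoVu2006, arXiv:math/0310476, arXiv:2302.05537, GowersWolf2010TrueComplexity
[crux] qualitative Roth-type theorem for the SDPP system: for every ε > 0 there is s₀ such that in
every finite abelian group every balanced two-families configuration with s ≥ s₀ has n·s ≤ ε|H| (the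
families occupy a vanishing fraction of the group). HalfDensity gives ε = 1/2 + o(1);
BalancedPowerGain implies it; it is the first statement an increment (relative half-density on Bohr
sets + the common-frequency bias) must deliver. [deps: HalfDensity, CommonFrequencyBias]
[difficulty: L] -/
@[route_item "route-MatrixMultiplication-FourierTwoFamilies"]
def DensityDecay : Prop :=
  ∀ ε : ℝ, 0 < ε → ∃ s₀ : ℕ, ∀ (H : Type) [AddCommGroup H] [Fintype H] (n s : ℕ) (A B : Fin n → Finset H), s₀ ≤ s → (∀ i : Fin n, (A i).card = s ∧ (B i).card = s) → (∀ i : Fin n, ∀ a ∈ A i, ∀ a' ∈ A i, ∀ b ∈ B i, ∀ b' ∈ B i, (a - a') + (b - b') = 0 → a = a' ∧ b = b') → (∀ i j k : Fin n, ∀ a ∈ A i, ∀ a' ∈ A j, ∀ b ∈ B j, ∀ b' ∈ B k, (a - a') + (b - b') = 0 → i = k) → (n : ℝ) * (s : ℝ) ≤ ε * (Fintype.card H : ℝ)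

/-- item stmt-MatrixMultiplication-5964 · crux · rank 5 · closed · moot by None · by planner
why it might fail: Evidence is thin: translates give ns² ≤ p and base-(2D+1) digit simulations of CKSU Prop 4.5 give ratio → 0, but overlapping matched-difference designs (multiplicity ≫ 1 on A_j − B_j) in Z/p were never searched; the (Z/3)^(2l) analogue is false with ratio (16/9)^l/√l.
sources: CohnKleinbergSzegedyUmans2005, Pratt2024, BlasiakCohnGrochowPrattUmans2023
[crux] the matched-difference wall in prime cyclic groups: an absolute C with n·s² ≤ C·p for every
balanced two-families configuration in ℤ/pℤ (the card's structural conjecture "N ≥ (1 − o(1)) n s²",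
weakened to a constant; translates of one direct pair attain n·s² ≈ p). Implies PrimeCyclicPowerGain
at once; its refutation (unbounded n·s²/p) would be the first overlapping-difference SDPP design in
a cyclic group and re-ranks the route. [difficulty: open-problem] -/
@[route_item "route-MatrixMultiplication-FourierTwoFamilies"]
def PrimeCyclicWall : Prop :=
  ∃ C : ℝ, ∀ p : ℕ, p.Prime → ∀ (n s : ℕ) (A B : Fin n → Finset (ZMod p)), (∀ i : Fin n, (A i).card = s ∧ (B i).card = s) → (∀ i : Fin n, ∀ a ∈ A i, ∀ a' ∈ A i, ∀ b ∈ B i, ∀ b' ∈ B i, (a - a') + (b - b') = 0 → a = a' ∧ b = b') → (∀ i j k : Fin n, ∀ a ∈ A i, ∀ a' ∈ A j, ∀ b ∈ B j, ∀ b' ∈ B k, (a - a') + (b - b') = 0 → i = k) → (n : ℝ) * (s : ℝ) ^ 2 ≤ C * (p : ℝ)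

/-- item stmt-MatrixMultiplication-5965 · support · rank 9 · closed · moot by None · by planner
sources: CohnKleinbergSzegedyUmans2005, Pratt2024
[support] (X) with all A_j, B_j non-empty forces the A_i pairwise disjoint and the B_i pairwise
disjoint (CKSU Prop. 4.6 proof; Pratt Prop. 2.6); hence Σ|A_i| ≤ |H|, Σ|B_i| ≤ |H|. Also a retriage
note for stmt-0595. [difficulty: provable-now] -/
@[route_item "route-MatrixMultiplication-FourierTwoFamilies"]
def PairwiseDisjoint : Prop :=
  ∀ (H : Type) [AddCommGroup H] (n : ℕ) (A B : Fin n → Finset H), (∀ i j k : Fin n, ∀ a ∈ A i, ∀ a' ∈ A j, ∀ b ∈ B j, ∀ b' ∈ B k, (a - a') + (b - b') = 0 → i = k) → (∀ i : Fin n, (A i).Nonempty ∧ (B i).Nonempty) → ∀ i j : Fin n, i ≠ j → Disjoint (A i) (A j) ∧ Disjoint (B i) (B j)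

/-- item stmt-MatrixMultiplication-5966 · support · rank 9 · closed · moot by None · by planner
sources: TaoVu2006, CohnKleinbergSzegedyUmans2005
[support] half-density theorem, balanced form: (W), (X), |A_i| = |B_i| = s ≥ 1 imply 2·n·s² ≤
|H|·(s+1), i.e. the families fill at most half the group up to 1/s (general form: αβ − |H|n ≤
√(α(|H|−α)β(|H|−β)) with α = Σ|A_i|, β = Σ|B_i|, tight on single factorizations A ⊕ B = H and on
CKSU's trivial example). Proof: the orthogonality identity Σ_ξ[conj(S_A)S_B·D − |D|²] = 0, the ξ = 0
term M(αβ − M), Σ_ξ|D|² ≤ |H|·n·M from (W), |D| ≤ M pointwise, Cauchy–Schwarz + Parseval for the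
indicators of the two disjoint unions. [difficulty: provable-now] -/
@[route_item "route-MatrixMultiplication-FourierTwoFamilies"]
def HalfDensity : Prop :=
  ∀ (H : Type) [AddCommGroup H] [Fintype H] (n s : ℕ) (A B : Fin n → Finset H), 1 ≤ s → (∀ i : Fin n, (A i).card = s ∧ (B i).card = s) → (∀ i : Fin n, ∀ a ∈ A i, ∀ a' ∈ A i, ∀ b ∈ B i, ∀ b' ∈ B i, (a - a') + (b - b') = 0 → a = a' ∧ b = b') → (∀ i j k : Fin n, ∀ a ∈ A i, ∀ a' ∈ A j, ∀ b ∈ B j, ∀ b' ∈ B k, (a - a') + (b - b') = 0 → i = k) → 2 * n * s ^ 2 ≤ Fintype.card H * (s + 1)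

/-- item stmt-MatrixMultiplication-5967 · support · rank 9 · closed · moot by None · by planner
sources: TaoVu2006, CohnKleinbergSzegedyUmans2005
[support] forced common-frequency bias beyond the wall: if (W), (X), |A_i| = |B_i| = s ≥ 1 and |H| <
n·s², there is a nontrivial character ψ of H with n·s·(n·s² − |H|) ≤ (|H| − n·s)·|Σ_i
Â_i(ψ)·conj(B̂_i(ψ))|, i.e. relative bias ≥ (ρ − 1/s)/(1 − ρ), ρ = ns/|H|, of the pair family at ONE
frequency (random level ≈ 1/s); checked on CKSU Prop 4.5 where a coordinate character gives |D| =
M/2. The inverse-theorem input of every increment in this route. [difficulty: provable-now] -/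
@[route_item "route-MatrixMultiplication-FourierTwoFamilies"]
def CommonFrequencyBias : Prop :=
  ∀ (H : Type) [AddCommGroup H] [Fintype H] (n s : ℕ) (A B : Fin n → Finset H), 1 ≤ s → (∀ i : Fin n, (A i).card = s ∧ (B i).card = s) → (∀ i : Fin n, ∀ a ∈ A i, ∀ a' ∈ A i, ∀ b ∈ B i, ∀ b' ∈ B i, (a - a') + (b - b') = 0 → a = a' ∧ b = b') → (∀ i j k : Fin n, ∀ a ∈ A i, ∀ a' ∈ A j, ∀ b ∈ B j, ∀ b' ∈ B k, (a - a') + (b - b') = 0 → i = k) → Fintype.card H < n * s ^ 2 → ∃ ψ : AddChar H ℂ, ψ ≠ 1 ∧ ((n : ℝ) * (s : ℝ)) * ((n : ℝ) * (s : ℝ) ^ 2 - (Fintype.card H : ℝ)) ≤ ((Fintype.card H : ℝ) - (n : ℝ) * (s : ℝ)) * ‖∑ i : Fin n, (∑ a ∈ A i, ψ a) * (starRingEnd ℂ) (∑ b ∈ B i, ψ b)‖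

/-- item stmt-MatrixMultiplication-5968 · assembly · rank 1 · closed · moot by None · by planner
sources: CohnKleinbergSzegedyUmans2005, Pratt2024
[assembly] BalancedPowerGain → TwoFamiliesRefutation (dyadic pigeonhole on the sizes via
PairwiseDisjoint, shrinking to a common size, reindexing a subfamily, exponent bookkeeping with δ <
c/(3+2c)). -/
@[route_item "route-MatrixMultiplication-FourierTwoFamilies"]
def Assembly : Prop :=
  BalancedPowerGain → TwoFamiliesRefutation

end Summit.MatrixMultiplication.MatrixMultiplication.Theses.FourierTwoFamilies
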